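import Literature.MathematicalPhysics.QuantumFieldTheory.Balaban1983to89.B8SockHFP59
import Literature.MathematicalPhysics.QuantumFieldTheory.Balaban1983to89.B8Prop3KLevelBdry
import Literature.MathematicalPhysics.QuantumFieldTheory.Balaban1983to89.B8Ineq159FlatMaps

/-!
# `Balaban1983to89.B8SockHFP59Bdry` — [Balaban1985RegularSpaces] PROPOSITION 5's fixed point for Theorem 4's level-`m` datum with
# Theorem 4's OWN (1.59)-clause IN THE REPAIRED CURRENCY (exterior-collar allowance + support clause) in place of the b9 socket

statement-level skeleton of published theorems with citation tags; proofs where landed; nothing here is a claim about the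
Yang–Mills mass gap

`[Balaban1985RegularSpaces]` CMP **99** (1985): Prop. 5 (1.106)–(1.109) p. 94, Thm 4 (1.66)–(1.69) p. 88, Prop. 3 p. 87, (1.58)–(1.62)
pp. 86–87, p. 77 (bond convention).  CITATION HEADER (lean-in-tree rule): cell `pub-ymgap` (D-0062), node N05 = [B8], seat
`pub-ymgap-dag-n05-e` g7 (R141 (C) row s3b — the FLAT LINE for Prop. 6 in the repaired currency).  WHY: g4's `B8SockHFP59` is Prop. 5's
step body for Theorem 4's induction with the b9 socket replaced by Theorem 4's own two-member (1.59) clause `H59m`; its consumer reads the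
clause off `H59₁`, certified UNSATISFIABLE at finite `Ω₀` by g5 (outer pure-gauge corner mode).  The located repair R-d (g6
`B8Prop3KLevelBdry`, `B8Prop3GaugeFixedKLevelBdry`) adds the level-0 exterior-collar allowance `+ B_∂·Φ₀(A′)` to both lines and the support
clause «`u₁ = 1` off `Ω₀`» to the datum, and bounds the allowance from (1.66)₀: on an outer collar bond `U₁ = U′`, so `η‖A′‖ ≤ 2α₁`, and
`4B_∂α₁ ≤ (dL − 1)B₀(α₀ + α₁)` is the slack of (1.60) ⇒ (1.62) under `4B_∂ ≤ (dL − 1)B₀`.  THIS FILE: §1 `grad_bound_of_datum59_bdry` = g4's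
§1 with the two members in the repaired form + `hu₁S`, `h66`, `(hBbd, hBd)`, the collar estimate and g6's `prop3_norms_kLevel_bdry_absorbed`
— SAME conclusion; §2 `sockHFP_body_of_join_59_bdry` = g4's §2 VERBATIM with `H59m ↦ H59Dm` and the same extra binders.  Kind
«kernel-checked proof», theorems only.  HONEST SCOPE: by-name re-runs; the repaired clause is a HYPOTHESIS of the datum ([4] Thm 3.3 for
`G(U₀)` on a finite region WITH exterior data), not discharged, not certified false; every letter ∕ window binder is g4's verbatim; `B_∂`,
`4B_∂ ≤ (dL − 1)B₀` are the tree's.  Count-neutral; N05 NOT discharged; one finite `𝕋⁴` programme at fixed `ε`, Bałaban as printed;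
nothing continuum ∕ ℝ⁴ ∕ OS ∕ mass-gap ∕ Clay.  No `sorry`, no `def`, no `instance`, no `notation`.  Unit `pub-ymgap-dag-n05-e` (g7), 2026-08-27.
-/

noncomputable section

open NormedSpace
open scoped BigOperators

namespace Literature.MathematicalPhysics.QuantumFieldTheory.Balaban1983to89.B8SockHFP59Bdry

open Complex (I)
open B7Prop1Explicit B7Prop2Explicit B7Prop1Local B7Eq92Concrete
open B7Prop2Explicit (C0 c2')
open B7Prop3Flat (c3)
open B7Prop10General (C6 C4G)
open B7Prop9Flat (C5')
open B7Eq78Linearization (conjR zdBlocking QprimeIter)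
open B8Ineq132 (covDerivFwd covDeriv InAk BondTouches)
open B8Eq119TwistedAxial (Restr129 InAx bgT)
open B8Eq184Proof (gaugeExp cfgExp)
open B8Eq182Proof (gAd)
open B8Eq188Proof (frakF3)
open B8Lemma1NonAbelian (mulCfg)
open B8Eq140Level (SideTouches sideTouches_mono)
open B8Eq146AExpansion (iEta expCfg)
open B8Ineq130 (tlo thi)
open B8Thm2LogB (blockTop)
open B8Eq138LandauZd (IsLandau138W covDivB covLap QT logCfg)
open B8Ineq159FlatMaps (logCfg_eq_of_cfgExp)
open B8Ineq125Concrete (C2p)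
open B8Eq1117Concrete (XSpace)
open B7Prop4GeneralLevels (logCovIter linCovIter)
open B8Eq155JBound (Jcur wsup expCfg_iEta_mem_unitaryUnits)
open B8ScaledSupNorm (bondNorm msup weight Bdd)
open B8Prop3GaugeFixedKLevel (expCfg_iEta_eq_cfgExp mem_unitaryUnits_of_mgauge_eq mulCfg_eq_gaugeAct_of_mgauge_eq
  inAk_congr_of_sideTouches)
open B8Prop5ContractionKLevel (Bd2 Mc Kc)
open B8LambdaSpaceKLevel (wt)
open B8Prop5SocketDatum (exists_masked_datum grad_bound_trivial bd2_covDivB_of_grad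
  restr129_succ_of_truncation sideTouches_pair_of_mem sideTouches_of_tower_bond h33_of_inAk hP_of_datum h69_of_datum hA_of_datum)
open B8Prop5JoinSectELocalRD (hFP_kLevel_of_sectE_local'_RD)
open B8SockHFPAssembly (isSelfAdjoint_covDivB covDivB_congr_at frakF3_congr_at inAx_mgauge_expCfg_of_datum)
open QuantumLattice (blockSites)

-- `Site` alone could resolve to the torus sites of `Setup.lean`; re-export the `ℤ^d` sites of `B7Prop1Explicit`.
export B7Prop1Explicit (Site)

variable {d : ℕ}

/-! ## §1 (1.69) from (1.67)–(1.68) by Proposition 3 at level `m`, the TWO (1.59) members of the datum WITH THE EXTERIOR-COLLAR ALLOWANCE -/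
section Grad

variable {𝔸 : Type*} [CStarAlgebra 𝔸] [Nontrivial 𝔸]

/-- **(1.69) FROM (1.67)–(1.68) BY PROPOSITION 3 AT LEVEL `m ≥ 1`, THE (1.59) INPUT AS TWO MEMBERS FOR THE DATUM IN THE REPAIRED CURRENCY**
— g4's `B8SockHFP59.grad_bound_of_datum59` with: the two (1.59) members `h59a`, `h59g` for the datum's own masked exponent `A′` at the
fixed background `U₀` carrying the exterior-collar allowance `+ B_∂·Φ₀(A′)`; the support clause `hu₁S` («`u₁ = 1` off `Ω₀`»); (1.66)₀
`h66`; `0 ≤ B_∂`, `4B_∂ ≤ (dL − 1)B₀`.  Everything else (setting, datum, Prop. 3's windows at `(α₀, α₂)` incl. (1.61), `dLα₁ ≤ 1/8`) as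
there.  SAME conclusion `(Lʲη)²|(∇^η_{U₀,κ}A′_τ)(y)| ≤ 5dLB₀(α₀ + α₁)` on the sides touching `Ω_j`, `j ≤ m`.  PROOF: as there + the collar
estimate `Φ₀(A′) ≤ 2α₁` (`U₁ = U′` on the outer collar, `‖log U′‖ ≤ 2‖U′ − 1‖`), then `B8Prop3KLevelBdry.prop3_norms_kLevel_bdry_absorbed`.
[cite: Balaban1985RegularSpaces, (1.66)–(1.69) p.88, Prop. 3 p.87, (1.40)–(1.42) p.83, (1.58)–(1.62) pp.86–87, Prop. 5 p.94, p.77] -/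
theorem grad_bound_of_datum59_bdry (hd2 : 2 ≤ d) {η : ℝ} (hη : 0 < η) {L : ℕ} (hL : 2 ≤ L) (K : ℕ)
    {U₀ U' : Site d → Fin d → 𝔸ˣ} (hU₀ : ∀ x κ, U₀ x κ ∈ unitaryUnits 𝔸) (hU' : ∀ x κ, U' x κ ∈ unitaryUnits 𝔸)
    {α₀ α₁ α₂ B₀ C₂ : ℝ} (hα₀ : 0 < α₀) (hα₁ : 0 < α₁) (hα₂ : 0 < α₂) (hB₀ : 0 ≤ B₀)
    -- Prop. 3's windows at `(α₀, α₂)` (cf. `B8LeafModelZd3.prop3_windows`), (1.61), and `dLα₁ ≤ 1/8`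
    (hα3 : C0 d * α₀ ≤ 1 / 3) (hα4 : 4 * α₀ ≤ c2' d L) (h16 : 16 * α₂ ≤ 1) (hd5 : 5 * α₂ * ((d : ℝ) - 1) ≤ 4)
    (hsmall : Real.exp (4 * (800 * ((d : ℝ) + 1) ^ 2 * ((d : ℝ) + 4)) * α₀) * (1 + 8 * (131072 * ((d : ℝ) + 1) ^ 2) * α₂) ≤ 2)
    (hc₃ : 2 * α₂ ≤ c3 d L) (hside : 36 * d * B₀ * α₂ ≤ 1 / 2) (h50 : 50 * d * α₂ ≤ 1)
    (hC₂ : 8 * (131072 * ((d : ℝ) + 1) ^ 2) * Real.exp (4 * (800 * ((d : ℝ) + 1) ^ 2 * ((d : ℝ) + 4)) * α₀) ≤ C₂)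
    (h61 : 2 * α₂ ^ 2 + 20 * d * α₀ * α₂ + 2 * C₂ * α₂ ^ 2 ≤ α₀ + α₁) (hsmall₁ : (d : ℝ) * L * α₁ ≤ 1 / 8)
    -- the member's geometry
    (Ω : ℕ → Set (Site d)) (hΩ : ∀ j, Ω (j + 1) ⊆ Ω j) (Λs : ℕ → ℕ → Set (Site d)) (Λb : ℕ → ℕ → Set (Site d × Fin d))
    (hbox : ∀ m, m ≤ K → ∀ j, j ≤ m → ∀ c ∈ Λb m j, ∀ x, InBox (loK L j c.1) (bondHiK L j c.1 c.2) x → x ∈ Ω j)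
    (hclass : ∀ m, m ≤ K → ∀ j, j ≤ m → ∀ c ∈ Λb m j,
      (c.1 ∈ Λs m j ∧ c.1 + e c.2 ∈ Λs m j) ∨
      (∃ j', j = j' + 1 ∧ (∀ x, (L : ℤ) • c.1 ≤ x → x ≤ (L : ℤ) • c.1 + blockTop L → x ∈ Λs m j') ∧ c.1 + e c.2 ∈ Λs m j) ∨
      (∃ j', j = j' + 1 ∧ c.1 ∈ Λs m j ∧ (∀ x, (L : ℤ) • (c.1 + e c.2) ≤ x → x ≤ (L : ℤ) • (c.1 + e c.2) + blockTop L → x ∈ Λs m j')))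
    -- the socket's antecedents: (1.33), (1.34), (1.35)/(1.66)
    (h33 : InAk L K η α₀ Ω U₀) (h34 : InAk L K η α₀ Ω (mulCfg U' U₀)) (hAx : ∀ m, m ≤ K → InAx L m (Λs m) U₀ (mulCfg U' U₀))
    (h135 : ∀ j, j ≤ K → ∀ (z : Site d) (μ : Fin d), (∀ x, InBox (loK L j z) (bondHiK L j z μ) x → x ∈ Ω j) →
      ‖(avgIter L (mulCfg U' U₀) j z μ : 𝔸) - (avgIter L U₀ j z μ : 𝔸)‖ ≤ α₁)
    -- (1.66)₀ on the sides touching `Ω₀` and the exterior-collar constant with its absorption window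
    (h66 : ∀ b ∈ {b : Site d × Fin d | SideTouches (Ω 0) b.1 b.2}, ‖((U' b.1 b.2 : 𝔸ˣ) : 𝔸) - 1‖ ≤ α₁)
    {Bbd : ℝ} (hBbd : 0 ≤ Bbd) (hBd : 4 * Bbd ≤ ((d : ℝ) * L - 1) * B₀)
    -- the level `m`
    {m : ℕ} (hm1 : 1 ≤ m) (hmK : m ≤ K)
    -- the datum at level `m`, with its masked exponent
    {u₁ : Site d → 𝔸ˣ} {U₁ : Site d → Fin d → 𝔸ˣ} {A' : Site d → Fin d → 𝔸}
    (hu₁ : ∀ x, u₁ x ∈ unitaryUnits 𝔸) (hu₁S : ∀ x, x ∉ Ω 0 → u₁ x = 1) (hW : mgauge U₀ u₁ U₁ = U')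
    (h129 : Restr129 L m (Λs m) U₀ u₁)
    (hLan : IsLandau138W L m η (Ω 0) (Λs m) U₀ U₁) (hsa : ∀ y τ, IsSelfAdjoint (A' y τ))
    (hWA : ∀ j, j ≤ m → ∀ (y : Site d) (τ : Fin d), SideTouches (Ω j) y τ →
      U₁ y τ = cfgExp η A' y τ ∧ ‖A' y τ‖ ≤ α₂ * ((L : ℝ) ^ j * η)⁻¹)
    (hA0 : ∀ (y : Site d) (τ : Fin d), (∀ j, j ≤ m → ¬ SideTouches (Ω j) y τ) → A' y τ = 0)
    -- the TWO (1.59) members for THIS datum at background `U₀`, EACH WITH THE EXTERIOR-COLLAR ALLOWANCE `+ B_∂·Φ₀(A′)`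
    (h59a : msup L m η (-(1 : ℝ)) (fun j (b : Site d × Fin d) => SideTouches (Ω j) b.1 b.2) (fun b => A' b.1 b.2)
        ≤ B₀ * (bondNorm L m η (-(3 : ℝ)) Ω (fun x μ => Jcur η U₀ A' μ x)
          + wsup 1 (fun p : {p : ℕ × (Site d × Fin d) // p.1 ≤ m ∧ p.2 ∈ Λb m p.1} =>
              linCovIter L U₀ (iEta η A') p.1.1 p.1.2.1 p.1.2.2))
          + Bbd * msup L m η (-(1 : ℝ)) (fun j (b : Site d × Fin d) => j = 0 ∧ SideTouches (Ω 0) b.1 b.2 ∧ ¬ BondTouches (Ω 0) b.1 b.2)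
              (fun b => A' b.1 b.2))
    (h59g : msup L m η (-(2 : ℝ)) (fun j (t : Fin d × Fin d × Site d) => SideTouches (Ω j) t.2.2 t.2.1)
          (fun t => covDerivFwd η U₀ t.1 (fun z => A' z t.2.1) t.2.2)
        ≤ B₀ * (bondNorm L m η (-(3 : ℝ)) Ω (fun x μ => Jcur η U₀ A' μ x)
          + wsup 1 (fun p : {p : ℕ × (Site d × Fin d) // p.1 ≤ m ∧ p.2 ∈ Λb m p.1} =>
              linCovIter L U₀ (iEta η A') p.1.1 p.1.2.1 p.1.2.2))
          + Bbd * msup L m η (-(1 : ℝ)) (fun j (b : Site d × Fin d) => j = 0 ∧ SideTouches (Ω 0) b.1 b.2 ∧ ¬ BondTouches (Ω 0) b.1 b.2)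
              (fun b => A' b.1 b.2)) :
    ∀ j, j ≤ m → ∀ (y : Site d) (κ τ : Fin d), SideTouches (Ω j) y τ →
      ((L : ℝ) ^ j * η) ^ 2 * ‖covDerivFwd η U₀ κ (fun z => A' z τ) y‖ ≤ 5 * d * L * B₀ * (α₀ + α₁) := by
  have hL1 : 1 ≤ L := le_trans (by norm_num) hL
  have hLr : (1 : ℝ) ≤ L := by exact_mod_cast hL1
  have hU₀1 : ∀ x κ, U₀ x κ ∈ U1 𝔸 := fun x κ => unitaryUnits_le_U1 (hU₀ x κ)
  -- the datum is unitary-valued; its class (1.40)₁ by gauge invariance and locality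
  have hWu : ∀ x κ, U₁ x κ ∈ unitaryUnits 𝔸 := mem_unitaryUnits_of_mgauge_eq hU₀ hU' hu₁ hW
  have h33m : InAk L m η α₀ Ω U₀ := fun j hj => h33 j (hj.trans hmK)
  have h34W : InAk L m η α₀ Ω (mulCfg U₁ U₀) := by
    have h1 : InAk L m η α₀ Ω (mulCfg U' U₀) := fun j hj => h34 j (hj.trans hmK)
    have hui : ∀ x, u₁⁻¹ x ∈ U1 𝔸 := fun x => unitaryUnits_le_U1 ((unitaryUnits 𝔸).inv_mem (hu₁ x))
    rw [mulCfg_eq_gaugeAct_of_mgauge_eq hW]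
    exact (B8Ineq132.inAk_gaugeAct_iff L m η α₀ Ω hui _).2 h1
  have h40₁ : InAk L m η α₀ Ω (mulCfg (expCfg (iEta η A')) U₀) := by
    refine (inAk_congr_of_sideTouches L m η α₀ (V := mulCfg U₁ U₀) fun j hj y τ hs => ?_).1 h34W
    show U₁ y τ * U₀ y τ = expCfg (iEta η A') y τ * U₀ y τ
    rw [(hWA j hj y τ hs).1, expCfg_iEta_eq_cfgExp]
  have h41' : ∀ j, j ≤ m → ∀ (y : Site d) (τ : Fin d), SideTouches (Ω j) y τ → ‖A' y τ‖ ≤ α₂ * ((L : ℝ) ^ j * η)⁻¹ :=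
    fun j hj y τ hs => (hWA j hj y τ hs).2
  -- the gradient datum (bounded family) and its supremum `g`
  have hgrad : ∀ (y : Site d) (κ τ : Fin d), ‖covDerivFwd η U₀ κ (fun z => A' z τ) y‖ ≤ 2 * α₂ * η⁻¹ * η⁻¹ := by
    intro y κ τ
    have h := grad_bound_trivial hη hL1 hU₀ hα₂.le h41' hA0 y κ τ
    have hη2 : 0 < η ^ 2 := by positivity
    rw [show 2 * α₂ * η⁻¹ * η⁻¹ = 2 * α₂ / η ^ 2 by field_simp, le_div_iff₀ hη2, mul_comm]
    exact h
  have hBg : Bdd L m η (-(2 : ℝ)) (fun j (t : Fin d × Fin d × Site d) => SideTouches (Ω j) t.2.2 t.2.1)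
      (fun t => covDerivFwd η U₀ t.1 (fun z => A' z t.2.1) t.2.2) := by
    have e2 : (-(2 : ℝ)) = -((2 : ℕ) : ℝ) := by norm_num
    rw [e2]
    refine B8ScaledSupNorm.bdd_of_forall (c := 2 * α₂ * ((L : ℝ) ^ m) ^ 2) fun j hj t _ => ?_
    rw [B8ScaledSupNorm.weight_neg_natCast L η 2 j]
    have hLjm : (L : ℝ) ^ j ≤ (L : ℝ) ^ m := pow_le_pow_right₀ hLr hj
    have hLj0 : (0 : ℝ) ≤ (L : ℝ) ^ j := by positivity
    calc ((L : ℝ) ^ j * η) ^ 2 * ‖covDerivFwd η U₀ t.1 (fun z => A' z t.2.1) t.2.2‖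
        ≤ ((L : ℝ) ^ j * η) ^ 2 * (2 * α₂ * η⁻¹ * η⁻¹) := mul_le_mul_of_nonneg_left (hgrad _ _ _) (by positivity)
      _ = 2 * α₂ * ((L : ℝ) ^ j) ^ 2 := by field_simp
      _ ≤ 2 * α₂ * ((L : ℝ) ^ m) ^ 2 := by gcongr
  set g : ℝ := msup L m η (-(2 : ℝ)) (fun j (t : Fin d × Fin d × Site d) => SideTouches (Ω j) t.2.2 t.2.1)
      (fun t => covDerivFwd η U₀ t.1 (fun z => A' z t.2.1) t.2.2) with hg_def
  have hg0 : 0 ≤ g := B8ScaledSupNorm.msup_nonneg L m hη.le _ _ _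
  have hg : ∀ j, j ≤ m → ∀ (y : Site d) (κ τ : Fin d), SideTouches (Ω j) y τ →
      ((L : ℝ) ^ j * η) ^ 2 * ‖covDerivFwd η U₀ κ (fun z => A' z τ) y‖ ≤ g := by
    intro j hj y κ τ hs
    have h := B8ScaledSupNorm.weight_mul_norm_le_msup hBg hj (i := (κ, τ, y)) hs
    have hw : weight L η (-(2 : ℝ)) j = ((L : ℝ) ^ j * η) ^ 2 := by
      have e2 : (-(2 : ℝ)) = -((2 : ℕ) : ℝ) := by norm_num
      rw [e2, B8ScaledSupNorm.weight_neg_natCast L η 2 j]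
    rw [hw] at h
    exact h
  -- (1.42)/(1.37) on the constraint bonds of the `m`-truncation, by the (1.42) lemma
  have h42 : ∀ j, j ≤ m → ∀ c ∈ Λb m j, ‖logCovIter L U₀ (iEta η A') j c.1 c.2‖ < 2 * d * L * α₁ :=
    B8Eq142KLevelLocal.H42_of_inAx hd2 hη hL K hU₀ hα₀ hα₁ hα₂.le hα3 hα4 h16 hsmall hc₃ hsmall₁ Ω hΩ Λs Λb hbox hclass h33 h34 hAx
      h135 (fun m W => IsLandau138W L m η (Ω 0) (Λs m) U₀ W) m hm1 hmK u₁ U₁ A' hu₁ hW h129 hLan hsa hWA hA0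
  have hboxm : ∀ j, j ≤ m → ∀ c ∈ Λb m j, ∀ x, InBox (loK L j c.1) (bondHiK L j c.1 c.2) x → x ∈ Ω j :=
    fun j hj c hc x hx => hbox m hmK j hj c hc x hx
  -- PROPOSITION 3 at `m` levels (n05-b): the gradient member
  -- THE EXTERIOR-COLLAR TERM: on a bond with both end-points outside `Ω₀`, `U₁ = U′` (support of `u₁`), so
  -- `η‖A′‖ = ‖log U′‖ ≤ 2‖U′ − 1‖ ≤ 2α₁` there ((1.66)₀), and `B_∂·Φ₀(A′) ≤ 2B_∂α₁` fits the slack window under `4B_∂ ≤ (dL − 1)B₀`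
  set Φ₀ : ℝ := msup L m η (-(1 : ℝ)) (fun j (b : Site d × Fin d) => j = 0 ∧ SideTouches (Ω 0) b.1 b.2 ∧ ¬ BondTouches (Ω 0) b.1 b.2)
      (fun b => A' b.1 b.2) with hΦ₀_def
  have hΦ₀ : Φ₀ ≤ 2 * α₁ := by
    refine B8ScaledSupNorm.msup_le (by linarith) fun j hj b hb => ?_
    obtain ⟨rfl, hsd, hnb⟩ := hb
    have e1 : (-(1 : ℝ)) = -((1 : ℕ) : ℝ) := by norm_num
    rw [e1, B8ScaledSupNorm.weight_neg_natCast L η 1 0, pow_one, pow_zero, one_mul]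
    -- both end-points of `b` lie outside `Ω₀`, so `U₁_b = U′_b`
    have hx : b.1 ∉ Ω 0 := fun h => hnb (Or.inl h)
    have hxe : b.1 + e b.2 ∉ Ω 0 := fun h => hnb (Or.inr h)
    have hWb : U₁ b.1 b.2 = U' b.1 b.2 := by
      have h := congrFun (congrFun hW b.1) b.2
      rw [mgauge_apply, hu₁S _ hx, hu₁S _ hxe, one_mul] at h
      simpa using h
    -- `A′_b = (1/iη) log U₁_b` (smallness from (1.68) at level `0`)
    obtain ⟨hWe, hAb⟩ := hWA 0 (Nat.zero_le _) b.1 b.2 hsd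
    have hsm : η * ‖A' b.1 b.2‖ ≤ 1 / 2 := by
      rw [pow_zero, one_mul] at hAb
      calc η * ‖A' b.1 b.2‖ ≤ η * (α₂ * η⁻¹) := mul_le_mul_of_nonneg_left hAb hη.le
        _ = α₂ := by field_simp
        _ ≤ 1 / 2 := by linarith [h16, hα₂.le]
    have hlog : logCfg η U₁ b.1 b.2 = A' b.1 b.2 := logCfg_eq_of_cfgExp hη hWe hsm
    have hdL : (1 : ℝ) ≤ (d : ℝ) * L := one_le_mul_of_one_le_of_one_le (by exact_mod_cast (le_trans (by norm_num) hd2 : 1 ≤ d)) hLr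
    have hα₁4 : α₁ ≤ 1 / 4 := by
      have h1 : α₁ ≤ (d : ℝ) * L * α₁ := le_mul_of_one_le_left hα₁.le hdL
      linarith [h1, hsmall₁]
    have hU'1 : ‖((U' b.1 b.2 : 𝔸ˣ) : 𝔸) - 1‖ ≤ 1 / 2 := (h66 b hsd).trans (by linarith [hα₁4])
    rw [← hlog, logCfg, hWb, norm_smul, norm_smul, norm_inv, norm_inv, Complex.norm_I, inv_one, one_mul, Real.norm_eq_abs,
      abs_of_pos hη, ← mul_assoc, mul_inv_cancel₀ hη.ne', one_mul]
    exact (MatrixLog.norm_mlog_le_two_mul hU'1).trans (by linarith [h66 b hsd])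
  have hΦ₀0 : 0 ≤ Φ₀ := B8ScaledSupNorm.msup_nonneg L m hη.le _ _ _
  have hdr : (1 : ℝ) ≤ d := by exact_mod_cast (le_trans (by norm_num) hd2 : 1 ≤ d)
  have hdL1 : (0 : ℝ) ≤ (d : ℝ) * L - 1 := by nlinarith [hdr, hLr]
  have hbdry : 4 * Bbd * α₁ ≤ ((d : ℝ) * L - 1) * B₀ * (α₀ + α₁) := by
    have h1 : 4 * Bbd * α₁ ≤ ((d : ℝ) * L - 1) * B₀ * α₁ := mul_le_mul_of_nonneg_right hBd hα₁.le
    have h2 : ((d : ℝ) * L - 1) * B₀ * α₁ ≤ ((d : ℝ) * L - 1) * B₀ * (α₀ + α₁) :=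
      mul_le_mul_of_nonneg_left (by linarith) (mul_nonneg hdL1 hB₀)
    exact h1.trans h2
  have hβ : Bbd * Φ₀ + Bbd * Φ₀ ≤ ((d : ℝ) * L - 1) * B₀ * (α₀ + α₁) := by nlinarith [hΦ₀, hbdry, hBbd, hΦ₀0]
  have hβg : 2 * (Bbd * Φ₀) ≤ ((d : ℝ) * L - 1) * B₀ * (α₀ + α₁) := by linarith [hβ]
  -- PROPOSITION 3 at `m` levels in the repaired currency (this seat's g6 `prop3_norms_kLevel_bdry_absorbed`): the gradient member
  obtain ⟨-, hg'⟩ := B8Prop3KLevelBdry.prop3_norms_kLevel_bdry_absorbed hd2 hη hL hU₀ hsa hα₀ hα₁.le hα₂.le hg0 hα3 hα4 h16 hd5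
    hsmall hc₃ hB₀ hside h50 hC₂ h61 hboxm h33m h40₁ h41' hg h42 hβ hβg h59a h59g
  intro j hj y κ τ hs
  exact (hg j hj y κ τ hs).trans hg'

end Grad

/-! ## §2 THE LEVEL-`m` ASSEMBLY: the ∃λ-body of `SockHFP` from the JOIN, the datum dictionary and the REPAIRED (1.59) clause -/
section Body

variable {𝔸 : Type*} [CStarAlgebra 𝔸] [Nontrivial 𝔸]
/-- **PROPOSITION 5'S FIXED POINT FOR THE LEVEL-`m` DATUM OF THEOREM 4, [4]'s INVERSE LAWS ON PRINT'S DOMAINS, WITH THEOREM 4'S OWN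
(1.59)-CLAUSE IN THE REPAIRED CURRENCY IN PLACE OF THE b9 SOCKET** — g4's `B8SockHFP59.sockHFP_body_of_join_59` VERBATIM (setting, member
geometry, the [4] letters at `(m + 1, U₀)` with their laws, (1.92)∕(1.98)∕(1.101), every window, and the CONCLUSION = the ∃λ-body of
`SockHFP` at this datum) except: the in-edge `H59m ↦ H59Dm` — Theorem 4's two-member (1.59) clause for every globally Hermitian exponent of
the datum at the fixed background, EACH LINE WITH THE EXTERIOR-COLLAR ALLOWANCE `+ B_∂·Φ₀(A′)` (the shape of `B8Thm4SupportLocalBdry`'s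
`H59D` and of `B8Prop6CubeMemberFlat3Bdry`'s `H59D₁`); the datum carries the support clause `hu₁S`; (1.66)₀ `h66`; `0 ≤ B_∂`,
`4B_∂ ≤ (dL − 1)B₀`.  PROOF: g4's, with §1's `grad_bound_of_datum59_bdry` for the source bound.
[cite: Balaban1985RegularSpaces, Prop. 5 (1.106)–(1.109) p.94, Thm 4 p.88, (1.66)–(1.69) p.88, p.89, (1.92)–(1.103) pp.92–93; Balaban1985BackgroundPropagators, Thm 3.1 p.397, (3.25) p.394, Thm 3.3 p.398] -/
theorem sockHFP_body_of_join_59_bdry (hd2 : 2 ≤ d) {L : ℕ} (hL : 2 ≤ L) {η : ℝ} (hη : 0 < η) {k : ℕ}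
    -- the member's geometry
    {Ω : ℕ → Set (Site d)} (hΩ : ∀ j, Ω (j + 1) ⊆ Ω j) {Λs : ℕ → ℕ → Set (Site d)} {Λb : ℕ → ℕ → Set (Site d × Fin d)}
    (hbox : ∀ m, m ≤ k → ∀ j, j ≤ m → ∀ c ∈ Λb m j, ∀ x, InBox (loK L j c.1) (bondHiK L j c.1 c.2) x → x ∈ Ω j)
    (hclass : ∀ m, m ≤ k → ∀ j, j ≤ m → ∀ c ∈ Λb m j,
      (c.1 ∈ Λs m j ∧ c.1 + e c.2 ∈ Λs m j) ∨
      (∃ j', j = j' + 1 ∧ (∀ x, (L : ℤ) • c.1 ≤ x → x ≤ (L : ℤ) • c.1 + blockTop L → x ∈ Λs m j') ∧ c.1 + e c.2 ∈ Λs m j) ∨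
      (∃ j', j = j' + 1 ∧ c.1 ∈ Λs m j ∧ (∀ x, (L : ℤ) • (c.1 + e c.2) ≤ x → x ≤ (L : ℤ) • (c.1 + e c.2) + blockTop L → x ∈ Λs m j')))
    {m : ℕ} (hm1 : 1 ≤ m) (hmk : m < k)
    (htower : ∀ j, j ≤ m + 1 → ∀ y ∈ Λs (m + 1) j, ∀ x, InBox (tlo L y j) (thi L y j) x → x ∈ Ω j)
    (hlt : ∀ j, j < m → Λs m j = Λs (m + 1) j)
    (htop : ∀ x, x ∈ Λs m m ↔ x ∈ Λs (m + 1) m ∨ ∃ y ∈ Λs (m + 1) (m + 1), x ∈ blockSites L y)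
    -- the socket's antecedents: constants, (1.33), (1.34), (1.35)/(1.66)
    {α₀ α₁ B₀ B₀' cs α₄ : ℝ} (hα₀ : 0 < α₀) (hα₁ : 0 < α₁) (hB₀ : 0 < B₀) (hB₀' : 0 < B₀')
    (hcs : cs = 5 * (d : ℝ) * L * B₀ * (α₀ + α₁)) (hα₄ : α₄ = 8 * B₀' * (5 * (d : ℝ) * L * B₀) * (α₀ + α₁))
    {U₀ U' : Site d → Fin d → 𝔸ˣ} (hU₀ : ∀ x κ, U₀ x κ ∈ unitaryUnits 𝔸) (hU' : ∀ x κ, U' x κ ∈ unitaryUnits 𝔸)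
    (h33 : InAk L k η α₀ Ω U₀) (h34 : InAk L k η α₀ Ω (mulCfg U' U₀)) (hAx : ∀ m', m' ≤ k → InAx L m' (Λs m') U₀ (mulCfg U' U₀))
    (h135 : ∀ j, j ≤ k → ∀ (z : Site d) (μ : Fin d), (∀ x, InBox (loK L j z) (bondHiK L j z μ) x → x ∈ Ω j) →
      ‖(avgIter L (mulCfg U' U₀) j z μ : 𝔸) - (avgIter L U₀ j z μ : 𝔸)‖ ≤ α₁)
    (h66 : ∀ b ∈ {b : Site d × Fin d | SideTouches (Ω 0) b.1 b.2}, ‖((U' b.1 b.2 : 𝔸ˣ) : 𝔸) - 1‖ ≤ α₁)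
    -- the exterior-collar constant and its absorption window
    {Bbd : ℝ} (hBbd : 0 ≤ Bbd) (hBd : 4 * Bbd ≤ ((d : ℝ) * L - 1) * B₀)
    -- the datum at level `m`
    {u₁ : Site d → 𝔸ˣ} {U₁ : Site d → Fin d → 𝔸ˣ} {A : Site d → Fin d → 𝔸}
    (hu₁ : ∀ x, u₁ x ∈ unitaryUnits 𝔸) (hu₁S : ∀ x, x ∉ Ω 0 → u₁ x = 1) (hW : mgauge U₀ u₁ U₁ = U')
    (h129 : Restr129 L m (Λs m) U₀ u₁)
    (hLan : IsLandau138W L m η (Ω 0) (Λs m) U₀ U₁)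
    (hdat : ∀ j, j ≤ m → ∀ b ∈ {b : Site d × Fin d | SideTouches (Ω j) b.1 b.2},
      U₁ b.1 b.2 = cfgExp η A b.1 b.2 ∧ IsSelfAdjoint (A b.1 b.2) ∧ ‖A b.1 b.2‖ ≤ cs * ((L : ℝ) ^ j * η)⁻¹)
    -- Theorem 4's own TWO-member (1.59) clause for the level-`m` datum at background `U₀`, WITH THE EXTERIOR-COLLAR ALLOWANCE
    (H59Dm : ∀ A' : Site d → Fin d → 𝔸, (∀ y τ, IsSelfAdjoint (A' y τ)) →
      (∀ j, j ≤ m → ∀ (y : Site d) (τ : Fin d), SideTouches (Ω j) y τ →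
        U₁ y τ = cfgExp η A' y τ ∧ ‖A' y τ‖ ≤ cs * ((L : ℝ) ^ j * η)⁻¹) →
      (∀ (y : Site d) (τ : Fin d), (∀ j, j ≤ m → ¬ SideTouches (Ω j) y τ) → A' y τ = 0) →
      msup L m η (-(1 : ℝ)) (fun j (b : Site d × Fin d) => SideTouches (Ω j) b.1 b.2) (fun b => A' b.1 b.2)
          ≤ B₀ * (bondNorm L m η (-(3 : ℝ)) Ω (fun x μ => Jcur η U₀ A' μ x)
            + wsup 1 (fun p : {p : ℕ × (Site d × Fin d) // p.1 ≤ m ∧ p.2 ∈ Λb m p.1} =>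
                linCovIter L U₀ (iEta η A') p.1.1 p.1.2.1 p.1.2.2))
            + Bbd * msup L m η (-(1 : ℝ)) (fun j (b : Site d × Fin d) => j = 0 ∧ SideTouches (Ω 0) b.1 b.2 ∧ ¬ BondTouches (Ω 0) b.1 b.2)
                (fun b => A' b.1 b.2) ∧
        msup L m η (-(2 : ℝ)) (fun j (t : Fin d × Fin d × Site d) => SideTouches (Ω j) t.2.2 t.2.1)
            (fun t => covDerivFwd η U₀ t.1 (fun z => A' z t.2.1) t.2.2)
          ≤ B₀ * (bondNorm L m η (-(3 : ℝ)) Ω (fun x μ => Jcur η U₀ A' μ x)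
            + wsup 1 (fun p : {p : ℕ × (Site d × Fin d) // p.1 ≤ m ∧ p.2 ∈ Λb m p.1} =>
                linCovIter L U₀ (iEta η A') p.1.1 p.1.2.1 p.1.2.2))
            + Bbd * msup L m η (-(1 : ℝ)) (fun j (b : Site d × Fin d) => j = 0 ∧ SideTouches (Ω 0) b.1 b.2 ∧ ¬ BondTouches (Ω 0) b.1 b.2)
                (fun b => A' b.1 b.2))
    -- Proposition 3's windows at `(α₀, α₂ := c⋆)` not implied by the JOIN's
    {C₂ : ℝ} (hside : 36 * d * B₀ * cs ≤ 1 / 2)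
    (hC₂ : 8 * (131072 * ((d : ℝ) + 1) ^ 2) * Real.exp (4 * (800 * ((d : ℝ) + 1) ^ 2 * ((d : ℝ) + 4)) * α₀) ≤ C₂)
    (h61 : 2 * cs ^ 2 + 20 * d * α₀ * cs + 2 * C₂ * cs ^ 2 ≤ α₀ + α₁) (hsmall₁ : (d : ℝ) * L * α₁ ≤ 1 / 8)
    -- the [4] LETTERS at `(m + 1, U₀)`, displayed as the JOIN reads them
    (g Δ : (Site d → 𝔸) →ₗ[ℂ] (Site d → 𝔸)) (q : (Site d → 𝔸) →ₗ[ℂ] (ℕ → Site d → 𝔸)) (qs : (ℕ → Site d → 𝔸) →ₗ[ℂ] (Site d → 𝔸))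
    (Aw c : (ℕ → Site d → 𝔸) →ₗ[ℂ] (ℕ → Site d → 𝔸))
    (g_rightΩ : ∀ x, ∀ y ∈ Ω 0, (Δ (g x) + qs (Aw (q (g x)))) y = x y)
    (c_range : ∀ f, q (g (g (qs (c (q f))))) = q f)
    (hΔ : ∀ (f : Site d → 𝔸), ∀ x ∈ Ω 0, Δ f x = covLap η U₀ ((Ω 0).indicator f) x)
    (hqs : ∀ (μ : ℕ → Site d → 𝔸), ∀ x ∈ Ω 0, qs μ x = QT L (m + 1) (Λs (m + 1)) U₀ μ x)
    (hq : ∀ (f : Site d → 𝔸) (j : ℕ), j ≤ m + 1 → ∀ y ∈ Λs (m + 1) j, q f j y = QprimeIter (zdBlocking d L) (bgT L U₀) j f y)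
    (H' : XSpace d (m + 1) 𝔸 →ₗ[ℂ] (Site d → 𝔸)) {B₀'H B₂' BG BR : ℝ} (hB₀'H : 0 < B₀'H) (hB₂' : 0 ≤ B₂') (hBG : 0 ≤ BG) (hBR : 0 ≤ BR)
    (hH0 : ∀ (X : XSpace d (m + 1) 𝔸) (x : Site d), ‖H' X x‖ ≤ B₀'H * ‖X‖)
    (hH1 : ∀ j, j ≤ m + 1 → ∀ (X : XSpace d (m + 1) 𝔸), ∀ p ∈ {b : Site d × Fin d | SideTouches (Ω j) b.1 b.2},
      wt L η j * ‖covDerivFwd η U₀ p.2 (H' X) p.1‖ ≤ B₀'H * ‖X‖)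
    (hH2 : ∀ X : XSpace d (m + 1) 𝔸, Bd2 L η (m + 1) Ω (covLap η U₀ (H' X)) (B₂' * ‖X‖))
    (hHsupp : ∀ (X : XSpace d (m + 1) 𝔸) (x : Site d), x ∉ Ω 0 → H' X x = 0)
    (hHequiv : ∀ X Y : XSpace d (m + 1) 𝔸, (∀ p, Y p = -star (X p)) → ∀ x, H' Y x = -star (H' X x))
    (hQH : ∀ (Y : XSpace d (m + 1) 𝔸) (j : ℕ) (hj : j ≤ m + 1) (y : Site d), y ∈ Λs (m + 1) j →
      QprimeIter (zdBlocking d L) (bgT L U₀) j (H' Y) y = Y (⟨j, Nat.lt_succ_of_le hj⟩, y))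
    (hG : ∀ (f : Site d → 𝔸) (r : ℝ), 0 ≤ r → Bd2 L η (m + 1) Ω f r →
      (∀ x, ‖g f x‖ ≤ BG * r) ∧ ∀ j, j ≤ m + 1 → ∀ p ∈ {b : Site d × Fin d | SideTouches (Ω j) b.1 b.2},
        wt L η j * ‖covDerivFwd η U₀ p.2 (g f) p.1‖ ≤ BG * r)
    (hGsupp : ∀ (f : Site d → 𝔸) (x : Site d), x ∉ Ω 0 → g f x = 0)
    (hGreal : ∀ f : Site d → 𝔸, (∀ j, j ≤ m + 1 → ∀ x ∈ Ω j, IsSelfAdjoint (f x)) → ∀ x, IsSelfAdjoint (g f x))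
    (hRbd : ∀ (f : Site d → 𝔸) (r : ℝ), 0 ≤ r → Bd2 L η (m + 1) Ω f r → Bd2 L η (m + 1) Ω (f - g (qs (c (q (g f))))) (BR * r))
    (hRreal : ∀ f : Site d → 𝔸, (∀ j, j ≤ m + 1 → ∀ x ∈ Ω j, IsSelfAdjoint (f x)) →
      ∀ j, j ≤ m + 1 → ∀ x ∈ Ω j, IsSelfAdjoint ((f - g (qs (c (q (g f))))) x))
    -- the JOIN's scalar windows, one-for-one (`αP := α₀`, `α₄ := 8B₀′c⋆`; `cB cA cDA` free above their datum values)
    {cB cA cDA : ℝ} (hcBlo : L * cs ≤ cB) (hcAlo : L * cs ≤ cA) (hcDAlo : (d : ℝ) * (L : ℝ) ^ 2 * cs ≤ cDA)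
    (hα3 : C0 d * α₀ ≤ 1 / 3) (hα4 : 4 * α₀ ≤ c2' d L)
    (hsmall : Real.exp (4 * (800 * ((d : ℝ) + 1) ^ 2 * ((d : ℝ) + 4)) * α₀) * (1 + 8 * (131072 * ((d : ℝ) + 1) ^ 2) * cB) ≤ 2)
    (hc₃ : 2 * cB ≤ c3 d L) (hsc : 2048 * (d : ℝ) * cB ≤ 1) (hα₃' : 40 * d * cB ≤ 1 / 200)
    (hs₁ : 200 * C6 d * (2 * α₄) ≤ 1) (hs₂ : 12000 * ((d : ℝ) + 1) * L * (2 * α₄) ≤ 1)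
    (hs₃ : C4G d L * (α₀ + 40 * d * cB + 4 * (2 * α₄)) ≤ 1)
    (hs₄ : 1024 * ((d : ℝ) + 1) * ((d : ℝ) + 4) * L ^ 2 * α₀ ≤ 1) (hs₅ : 32 * ((d : ℝ) + 1) ^ 2 * C6 d * L ^ 2 * α₀ ≤ 1)
    (hs₆ : 16 * d * C5' d * C6 d * (L : ℝ) ^ 2 * α₀ ≤ 1) (hs₇ : 8 * d * C6 d * L * α₀ ≤ 1)
    (hsm : 40 * d * cB + α₄ ≤ 1 / (4 * B₀'H * (2 * C2p d))) (hprod8 : 2 * C6 d * (40 * d * cB + 4 * α₄) ≤ 1 / 8)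
    {hE hE₂ lE lE₂ : ℝ} (hE_def : hE = B₀'H * (C2p d * (40 * d * cB + α₄) * α₄)) (hE₂_def : hE₂ = B₂' * (C2p d * (40 * d * cB + α₄) * α₄))
    (lE_def : lE = B₀'H * (4 * C2p d * (40 * d * cB + 2 * α₄))) (lE₂_def : lE₂ = B₂' * (4 * C2p d * (40 * d * cB + 2 * α₄)))
    (hcA' : cA ≤ 1 / 13) (ha₁' : α₄ / 4 + hE ≤ 1 / 24) (hb₁' : α₄ / 4 + hE ≤ 1 / 140) (hθ : 10 * (α₄ / 4 + hE) * BR ≤ 1 / 2)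
    (h103 : BG * Mc d BR (α₄ / 4 + hE) cA hE₂ cDA ≤ α₄ / 4)
    (h106 : BG * Kc d BR (α₄ / 4 + hE) cA hE₂ cDA lE₂ (1 + lE) (1 + lE) ≤ 1 / 2) :
    ∃ lam : Site d → 𝔸, (∀ x, IsSelfAdjoint (lam x)) ∧ (∀ x, x ∉ Ω 0 → lam x = 0) ∧
      (∀ j, j ≤ m + 1 → ∀ b ∈ {b : Site d × Fin d | SideTouches (Ω j) b.1 b.2},
        ‖lam b.1‖ ≤ α₄ ∧ ((L : ℝ) ^ j * η) * ‖covDerivFwd η U₀ b.2 lam b.1‖ ≤ α₄) ∧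
      (∃ μ : ℕ → Site d → 𝔸, ∀ x ∈ Ω 0,
        covLap η U₀ ((Ω 0).indicator fun y => covDivB η U₀ A y + covLap η U₀ lam y +
          ((conjR (gaugeExp lam y)⁻¹ (covDivB η U₀ A y) - covDivB η U₀ A y) +
            (gAd (covLap η U₀ lam y) (lam y) - covLap η U₀ lam y) + ∑ μ, frakF3 η U₀ lam A y μ)) x =
          QT L (m + 1) (Λs (m + 1)) U₀ μ x) ∧
      Restr129 L (m + 1) (Λs (m + 1)) U₀ (u₁ * gaugeExp lam) := by
  subst hcs
  have hL1 : 1 ≤ L := le_trans (by norm_num) hL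
  have hd1 : 1 ≤ d := le_trans (by norm_num) hd2
  have hLr : (1 : ℝ) ≤ L := by exact_mod_cast hL1
  have hmK : m + 1 ≤ k := hmk
  have hsum : 0 < α₀ + α₁ := add_pos hα₀ hα₁
  have hcs0 : 0 ≤ 5 * (d : ℝ) * L * B₀ * (α₀ + α₁) := by positivity
  have hcspos : 0 < 5 * (d : ℝ) * L * B₀ * (α₀ + α₁) := by positivity
  have hα₄pos : 0 < α₄ := by rw [hα₄]; positivity
  -- `c⋆ ≤ L·c⋆ ≤ cB`, hence Prop. 3's remaining windows from the JOIN's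
  have hcsB : 5 * (d : ℝ) * L * B₀ * (α₀ + α₁) ≤ cB := (le_mul_of_one_le_left hcs0 hLr).trans hcBlo
  have hcB0 : 0 ≤ cB := hcs0.trans hcsB
  have hcA0 : 0 ≤ cA := (hcs0.trans (le_mul_of_one_le_left hcs0 hLr)).trans hcAlo
  have hcDA0 : 0 ≤ cDA := le_trans (by positivity) hcDAlo
  have hd0 : (1 : ℝ) ≤ d := by exact_mod_cast hd1
  have hcBsmall : (d : ℝ) * cB ≤ 1 / 8000 := by linarith only [hα₃']
  have hdcs : (d : ℝ) * (5 * (d : ℝ) * L * B₀ * (α₀ + α₁)) ≤ 1 / 8000 :=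
    (mul_le_mul_of_nonneg_left hcsB (by positivity)).trans hcBsmall
  have hcs8000 : 5 * (d : ℝ) * L * B₀ * (α₀ + α₁) ≤ 1 / 8000 := (le_mul_of_one_le_left hcs0 hd0).trans hdcs
  have h16 : 16 * (5 * (d : ℝ) * L * B₀ * (α₀ + α₁)) ≤ 1 := by linarith only [hcs8000]
  have h50 : 50 * d * (5 * (d : ℝ) * L * B₀ * (α₀ + α₁)) ≤ 1 := by linarith only [hdcs]
  have hd5 : 5 * (5 * (d : ℝ) * L * B₀ * (α₀ + α₁)) * ((d : ℝ) - 1) ≤ 4 := by nlinarith only [hdcs, hcs0]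
  have hc₃3 : 2 * (5 * (d : ℝ) * L * B₀ * (α₀ + α₁)) ≤ c3 d L := by linarith only [hc₃, hcsB]
  have hsmall3 : Real.exp (4 * (800 * ((d : ℝ) + 1) ^ 2 * ((d : ℝ) + 4)) * α₀) *
      (1 + 8 * (131072 * ((d : ℝ) + 1) ^ 2) * (5 * (d : ℝ) * L * B₀ * (α₀ + α₁))) ≤ 2 := by
    refine le_trans (mul_le_mul_of_nonneg_left ?_ (Real.exp_pos _).le) hsmall
    have h := mul_le_mul_of_nonneg_left hcsB (show (0 : ℝ) ≤ 8 * (131072 * ((d : ℝ) + 1) ^ 2) by positivity)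
    linarith only [h]
  have hαP2 : 2 * α₀ ≤ c2' d L := by linarith only [hα4, hα₀]
  -- the MASKED exponent `A′` of the datum (globally Hermitian, `= A` on the touched bonds)
  obtain ⟨A', hsa, hagree, hWA, hA0⟩ := exists_masked_datum hdat
  have hWA1 : ∀ j, j ≤ m → ∀ (y : Site d) (τ : Fin d), SideTouches (Ω j) y τ → U₁ y τ = cfgExp η A' y τ :=
    fun j hj y τ hs => (hWA j hj y τ hs).1
  have h41 : ∀ j, j ≤ m → ∀ (y : Site d) (τ : Fin d), SideTouches (Ω j) y τ →
      ‖A' y τ‖ ≤ (5 * (d : ℝ) * L * B₀ * (α₀ + α₁)) * ((L : ℝ) ^ j * η)⁻¹ := fun j hj y τ hs => (hWA j hj y τ hs).2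
  -- the JOIN's datum binders BY NAME (`B8Prop5SocketDatum` §7, §1, §5)
  have h33' := h33_of_inAk hL1 hα₀ h33 hmK htower
  have hP' := hP_of_datum hL1 hα₀ hΩ h34 hmK htower hu₁ hW hWA1
  have h69' : ∀ j, j ≤ m + 1 → ∀ y ∈ Λs (m + 1) j, ∀ (x : Site d) (κ : Fin d), InBox (tlo L y j) (thi L y j) x →
      InBox (tlo L y j) (thi L y j) (x + e κ) → ‖iEta η A' x κ‖ ≤ cB * ((L : ℝ) ^ j)⁻¹ :=
    fun j hj y hy x κ hx hxe =>
      (h69_of_datum hd2 hL1 hη hΩ htower hcs0 h41 j hj y hy x κ hx hxe).trans (mul_le_mul_of_nonneg_right hcBlo (by positivity))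
  have hA' : ∀ j, j ≤ m + 1 → ∀ x ∈ Ω j, ∀ μ : Fin d,
      wt L η j * ‖A' x μ‖ ≤ cA ∧ wt L η j * ‖conjR (U₀ (x - e μ) μ)⁻¹ (A' (x - e μ) μ)‖ ≤ cA := fun j hj x hx μ =>
    ⟨(hA_of_datum hd2 hL1 hη hΩ hU₀ hcs0 h41 j hj x hx μ).1.trans hcAlo, (hA_of_datum hd2 hL1 hη hΩ hU₀ hcs0 h41 j hj x hx μ).2.trans hcAlo⟩
  have hBu : ∀ (x : Site d) (κ : Fin d), expCfg (iEta η A') x κ ∈ unitaryUnits 𝔸 := expCfg_iEta_mem_unitaryUnits η hsa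
  have hAx' : InAx L (m + 1) (Λs (m + 1)) U₀ (mgauge U₀ u₁ (expCfg (iEta η A')) * U₀) :=
    inAx_mgauge_expCfg_of_datum hd2 hL1 hΩ htower hW hWA1 (hAx (m + 1) hmK)
  have h129' : Restr129 L (m + 1) (Λs (m + 1)) U₀ u₁ := restr129_succ_of_truncation hL1 hlt htop h129
  -- the source `D*A′`: (1.69)'s gradient member by Prop. 3 at level `m` (§3), then `|D*A′|₍₋₂₎ ≤ d·L²·c⋆ ≤ cDA` (§4); Hermitian
  obtain ⟨h59a, h59g⟩ := H59Dm A' hsa hWA hA0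
  have hgrad := grad_bound_of_datum59_bdry hd2 hη hL k hU₀ hU' hα₀ hα₁ hcspos hB₀.le hα3 hα4 h16 hd5 hsmall3 hc₃3 hside h50 hC₂ h61
    hsmall₁ Ω hΩ Λs Λb hbox hclass h33 h34 hAx h135 h66 hBbd hBd hm1 hmk.le hu₁ hu₁S hW h129 hLan hsa hWA hA0 h59a h59g
  have hDA : Bd2 L η (m + 1) Ω (fun y => covDivB η U₀ A' y) cDA := fun j hj x hx =>
    (bd2_covDivB_of_grad hd2 hL1 hη hΩ hU₀ hcs0 hgrad j hj x hx).trans hcDAlo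
  have hDAsa : ∀ j, j ≤ m + 1 → ∀ x ∈ Ω j, IsSelfAdjoint (covDivB η U₀ A' x) := fun j _ x _ => isSelfAdjoint_covDivB hU₀ hsa x
  -- the JOIN's bond classes `Eb j := {b ∣ SideTouches (Ω j) b}` (§6)
  have hEbΩ : ∀ j, j ≤ m + 1 → ∀ x ∈ Ω j, ∀ μ : Fin d, (x, μ) ∈ {b : Site d × Fin d | SideTouches (Ω j) b.1 b.2} ∧
      (x - e μ, μ) ∈ {b : Site d × Fin d | SideTouches (Ω j) b.1 b.2} := fun j _ x hx μ => sideTouches_pair_of_mem hd2 hx μ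
  have hEbT : ∀ j, j ≤ m + 1 → ∀ y ∈ Λs (m + 1) j, ∀ (x : Site d) (κ : Fin d), InBox (tlo L y j) (thi L y j) x →
      InBox (tlo L y j) (thi L y j) (x + e κ) → (x, κ) ∈ {b : Site d × Fin d | SideTouches (Ω j) b.1 b.2} :=
    fun j hj y hy x κ hx _ => sideTouches_of_tower_bond hd2 htower hj hy x κ hx
  -- THE JOIN WITH THE LAWS ON PRINT'S DOMAINS (`hFP_kLevel_of_sectE_local'_RD`, BY NAME) at `k := m + 1`, `Λs := Λs (m+1)`, `B := iηA′`, `αP := α₀`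
  obtain ⟨lam, hlsa, hloff, h108, ⟨μ, hmul⟩, h129''⟩ := hFP_kLevel_of_sectE_local'_RD (k := m + 1) (Λs := Λs (m + 1))
    (Eb := fun j => {b : Site d × Fin d | SideTouches (Ω j) b.1 b.2}) (u₁ := u₁) (A := A') hL hη hU₀ hEbΩ hEbT g Δ q qs Aw c
    g_rightΩ c_range hΔ hqs hq H' hα₀ hα3 hα4 hcB0 hα₄pos hB₀'H hB₂' h33' h69' hd1 hα₀ hα3 hαP2 hBu hP' hAx' h129' hH0 hH1 hH2 hHsupp
    hHequiv hQH hsmall hc₃ hsc hα₃' hs₁ hs₂ hs₃ hs₄ hs₅ hs₆ hs₇ hsm hprod8 hE_def hE₂_def lE_def lE₂_def hBG hBR hcA0 hcA' hcDA0 ha₁' hb₁'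
    hθ hG hGsupp hGreal hRbd hRreal hDA hDAsa hA' hsa h103 h106
  refine ⟨lam, hlsa, hloff, fun j hj b hb => h108 j hj b hb, ⟨μ, fun x hx => ?_⟩, h129''⟩
  -- transport the multiplier clause from `A′` back to `A`: the two agree on the bonds read on `Ω₀`
  have hind : ((Ω 0).indicator fun y => covDivB η U₀ A y + covLap η U₀ lam y +
        ((conjR (gaugeExp lam y)⁻¹ (covDivB η U₀ A y) - covDivB η U₀ A y) +
          (gAd (covLap η U₀ lam y) (lam y) - covLap η U₀ lam y) + ∑ μ, frakF3 η U₀ lam A y μ)) =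
      ((Ω 0).indicator fun y => covDivB η U₀ A' y + covLap η U₀ lam y +
        ((conjR (gaugeExp lam y)⁻¹ (covDivB η U₀ A' y) - covDivB η U₀ A' y) +
          (gAd (covLap η U₀ lam y) (lam y) - covLap η U₀ lam y) + ∑ μ, frakF3 η U₀ lam A' y μ)) := by
    refine Set.indicator_congr fun y hy => ?_
    have h₁ : ∀ ν : Fin d, A' y ν = A y ν := fun ν => hagree 0 (Nat.zero_le _) y ν (sideTouches_pair_of_mem hd2 hy ν).1
    have h₂ : ∀ ν : Fin d, A' (y - e ν) ν = A (y - e ν) ν := fun ν => hagree 0 (Nat.zero_le _) (y - e ν) ν (sideTouches_pair_of_mem hd2 hy ν).2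
    have h₃ : ∀ ν : Fin d, frakF3 η U₀ lam A' y ν = frakF3 η U₀ lam A y ν := fun ν => frakF3_congr_at η U₀ lam (h₁ ν) (h₂ ν)
    simp only [covDivB_congr_at η U₀ h₁ h₂, h₃]
  rw [hind]
  exact hmul x hx
end Body
#print axioms grad_bound_of_datum59_bdry
#print axioms sockHFP_body_of_join_59_bdry

end Literature.MathematicalPhysics.QuantumFieldTheory.Balaban1983to89.B8SockHFP59Bdry

end
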